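import Literature.NumberTheory.EllipticCurves.BurungaleTian2026.EtaSignedMainConjectureTensorQ
import Literature.NumberTheory.EllipticCurves.GreenbergVatsal2000.CongruentCurves
import Literature.NumberTheory.EllipticCurves.IwasawaAlgebraDivisibilityProofs
import Literature.NumberTheory.EllipticCurves.IwasawaAlgebraProofs
import Literature.NumberTheory.EllipticCurves.IwasawaAlgebraCharIdealProofs
import HarnessLib

/-!
# `μ`-invariants of quotients over `Λ = ℤ_p⟦T⟧` at the prime `(p)`: monotonicity along surjections,
# `0 ≠ Z ⊆ p^n H ≅ p^n Λ ⟹ μ(H/Z) ≥ n`, and `μ(Λ/(a)) = 0 ⟺ a ∉ pΛ` — proofs only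

Sibling proof file of `IwasawaAlgebra.lean` / `IwasawaAlgebraProofs.lean` / `IwasawaAlgebraMuAdditiveProofs.lean`
(D-0014; namespace = path `Literature.NumberTheory.EllipticCurves`).  Five corollaries of the structure
theory of finitely generated `Λ`-modules (Lang, *Cyclotomic Fields I and II*, Ch. 5 §§1–3: the
decomposition `(*)` `V ∼ Λ^{(r)} ⊕ ∏ Λ/(p^{mᵢ}) ⊕ ∏ Λ/(fⱼ)` with `μ = Σ mᵢ`, Thm. 1.2 (i) `μ(Λ/p^m) = m`,
Thm. 2.2 Weierstrass preparation, §3 «an element of `Λ` is `p`-free iff it does not lie in `pΛ`»;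
Greenberg LNM 1716 §5 «both `λ` and `μ` are additive»; Washington §13.2), in the tree's currency
`IwasawaAlgebra.muInvariant p M = (length_{Λ_(p)} M_(p)).toNat` (`muInvariant_eq_toNat_lengthAt`):

* `muInvariant_le_of_surjective` — `π : X ↠ Y`, `X` f.g. torsion ⟹ `μ(Y) ≤ μ(X)`;
* `le_muInvariant_quotient_of_le_pow_smul_top` — `e : H ≃ Λ`, `0 ≠ Z ≤ p^n H` ⟹ `n ≤ μ(H/Z)`
  («Euler DEPTH ≤ Euler LOSS», the form used by the Euler-system lens of cell `bsd-f3-mu`);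
* `muInvariant_quotient_span_eq_zero_of_not_mem` — `a ∉ (p)` ⟹ `μ(Λ/(a)) = 0`;
* `not_mem_augIdealP_of_muInvariant_quotient_eq_zero` — `a ≠ 0`, `μ(Λ/(a)) = 0` ⟹ `a ∉ (p)`;
* `exists_norm_coeff_eq_one_of_not_mem_augIdealP` — `a ∉ (p)` ⟹ `∃ n, ‖coeff_n (ι a)‖ = 1` (the
  unit-coefficient certificate of the cells' `μ^an = 0` currency, via `GreenbergVatsal2000.HasUnitContent`).

Written for the typer seat of cell `bsd-f3-mu` (transcription of `HOME/es/EulerLossChartExact.lean` §1,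
sha16 4b5b6c8384c6f496, rc 0); no definitions, no named facts.

References: S. Lang, *Cyclotomic Fields I and II*, GTM 121 (1990), Ch. 5 §1 (*), Thm. 1.2, §2 Thm. 2.2,
§3 Thm. 3.1 [Lang1990]; R. Greenberg, LNM 1716 (1999), §5, Remark following Cor. 5.5 [GreenbergLNM1716];
L. Washington, GTM 83, §13.2 [Washington1997].
-/

noncomputable section

open scoped Classical
open Literature.NumberTheory.EllipticCurves
open Literature.NumberTheory.EllipticCurves.GreenbergVatsal2000 (HasUnitContent
  hasUnitContent_iff_exists_norm_coeff_map_eq_one hasUnitContent_iff_not_C_dvd)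
open Module IwasawaAlgebra

namespace Literature.NumberTheory.EllipticCurves

section MuQuotient

variable {p : ℕ} [Fact p.Prime]

/-- **`μ` does not increase along a surjection from a finitely generated torsion `Λ`-module**:
`π : X ↠ Y` ⟹ `μ(Y) ≤ μ(X)` (lengths at `(p)` are finite for `X` and monotone under surjections) — a
corollary of the structure theory (`μ = Σ mᵢ` in `V ∼ Λ^{(r)} ⊕ ∏ Λ/(p^{mᵢ}) ⊕ ∏ Λ/(fⱼ)`).
[cite: GreenbergLNM1716, §5, Remark following Cor. 5.5 («Both λ and μ are additive» in exact sequences; corollary: `μ` is monotone along surjections of torsion modules)]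
[cite: Lang1990, Ch. 5 §1 (*) with Thm. 1.2 (iii) and §3 Thm. 3.1 (structure theorem, `μ = Σ mᵢ`)] -/
theorem muInvariant_le_of_surjective {X Y : Type*} [AddCommGroup X] [Module (IwasawaAlgebra p) X]
    [AddCommGroup Y] [Module (IwasawaAlgebra p) Y] [Module.Finite (IwasawaAlgebra p) X]
    (hXt : Module.IsTorsion (IwasawaAlgebra p) X)
    (π : X →ₗ[IwasawaAlgebra p] Y) (hπs : Function.Surjective π) :
    muInvariant p Y ≤ muInvariant p X := by
  let 𝔭 : PrimeSpectrum (IwasawaAlgebra p) := ⟨augIdealP p, isPrime_augIdealP_holds p⟩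
  have hXfin : lengthAt (IwasawaAlgebra p) X 𝔭 ≠ ⊤ := lengthAt_ne_top_of_isTorsion p _ hXt 𝔭 rfl
  have hle : lengthAt (IwasawaAlgebra p) Y 𝔭 ≤ lengthAt (IwasawaAlgebra p) X 𝔭 :=
    lengthAt_le_of_surjective π hπs 𝔭
  rw [muInvariant_eq_toNat_lengthAt p Y 𝔭 rfl, muInvariant_eq_toNat_lengthAt p X 𝔭 rfl]
  exact ENat.toNat_le_toNat hle hXfin

/-- **Euler DEPTH bounds Euler LOSS**: if `H ≅ Λ` (e.g. Kato's `𝐇¹` for `p ≠ 2` and `E[p]` irreducible,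
Thm. 12.4 (3)) and a non-zero submodule `Z ≤ H` lies in `p^n H`, then `n ≤ μ(H/Z)`: transporting to the
ideal `J = e(Z)` of `Λ`, `n = μ(Λ/(p^n)) ≤ μ(Λ/J)`, all lengths at `(p)` finite because `J ∋ e z ≠ 0`
(the free rank-one `𝐇¹` is Kato's Thm. 12.4 (3), p. 221).
[cite: Lang1990, Ch. 5 §1 Thm. 1.2 (i) (`μ(Λ/p^m) = m`; corollary: a quotient `Λ/J` with `0 ≠ J ⊆ p^nΛ` has `μ ≥ n`)] -/
theorem le_muInvariant_quotient_of_le_pow_smul_top {H : Type*} [AddCommGroup H]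
    [Module (IwasawaAlgebra p) H] (e : H ≃ₗ[IwasawaAlgebra p] IwasawaAlgebra p)
    {Z : Submodule (IwasawaAlgebra p) H} (hZ : Z ≠ ⊥) {n : ℕ}
    (hZn : Z ≤ (augIdealP p ^ n) • (⊤ : Submodule (IwasawaAlgebra p) H)) :
    n ≤ muInvariant p (H ⧸ Z) := by
  let 𝔭 : PrimeSpectrum (IwasawaAlgebra p) := ⟨augIdealP p, isPrime_augIdealP_holds p⟩
  -- transport to an ideal `J = e(Z)` of `Λ`
  set J : Ideal (IwasawaAlgebra p) := Submodule.map (e : H →ₗ[IwasawaAlgebra p] IwasawaAlgebra p) Z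
    with hJ
  have hHZ : lengthAt (IwasawaAlgebra p) (H ⧸ Z) 𝔭 =
      lengthAt (IwasawaAlgebra p) (IwasawaAlgebra p ⧸ J) 𝔭 :=
    lengthAt_eq_of_linearEquiv (Submodule.Quotient.equiv Z J e rfl) 𝔭
  -- `J ≤ (p^n)`
  have hpn : (augIdealP p ^ n : Ideal (IwasawaAlgebra p)) =
      Ideal.span {(p : IwasawaAlgebra p) ^ n * 1} := by
    rw [mul_one, augIdealP, Ideal.span_singleton_pow, map_natCast]
  have hJle : J ≤ Ideal.span {(p : IwasawaAlgebra p) ^ n * 1} := by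
    rw [← hpn, hJ]
    refine (Submodule.map_mono hZn).trans ?_
    rw [Submodule.map_smul'', Submodule.map_top, LinearEquiv.range, Ideal.smul_eq_mul, Ideal.mul_top]
  -- `J ∋ e z ≠ 0`
  obtain ⟨z, hzZ, hz0⟩ := (Submodule.ne_bot_iff Z).mp hZ
  have haJ : e z ∈ J := Submodule.mem_map_of_mem hzZ
  have ha0 : e z ≠ 0 := fun h0 ↦ hz0 (e.injective (by rw [h0, map_zero]))
  -- lengths at `(p)`: `n = ℓ(Λ/(p^n)) ≤ ℓ(Λ/J) ≤ ℓ(Λ/(e z)) < ⊤`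
  have h1 : lengthAt (IwasawaAlgebra p) (IwasawaAlgebra p ⧸ Ideal.span {(p : IwasawaAlgebra p) ^ n * 1}) 𝔭
      ≤ lengthAt (IwasawaAlgebra p) (IwasawaAlgebra p ⧸ J) 𝔭 :=
    lengthAt_le_of_surjective
      (Submodule.mapQ J (Ideal.span {(p : IwasawaAlgebra p) ^ n * 1}) LinearMap.id
        fun x hx ↦ hJle hx)
      (fun y ↦ by obtain ⟨x, rfl⟩ := Submodule.mkQ_surjective _ y; exact ⟨Submodule.Quotient.mk x, rfl⟩) 𝔭
  have h2 : lengthAt (IwasawaAlgebra p) (IwasawaAlgebra p ⧸ J) 𝔭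
      ≤ lengthAt (IwasawaAlgebra p) (IwasawaAlgebra p ⧸ Ideal.span {e z}) 𝔭 :=
    lengthAt_le_of_surjective
      (Submodule.mapQ (Ideal.span {e z}) J LinearMap.id
        fun x hx ↦ (Ideal.span_singleton_le_iff_mem _).mpr haJ hx)
      (fun y ↦ by obtain ⟨x, rfl⟩ := Submodule.mkQ_surjective _ y; exact ⟨Submodule.Quotient.mk x, rfl⟩) 𝔭
  have hby : Module.IsTorsionBy (IwasawaAlgebra p) (IwasawaAlgebra p ⧸ Ideal.span {e z}) (e z) :=
    (Module.isTorsionBy_quotient_iff _ _).mpr fun y ↦ by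
      rw [smul_eq_mul]
      exact Ideal.mul_mem_right y _ (Ideal.mem_span_singleton_self _)
  have hfin : lengthAt (IwasawaAlgebra p) (IwasawaAlgebra p ⧸ Ideal.span {e z}) 𝔭 ≠ ⊤ :=
    Module.lengthAt_ne_top_of_isTorsionBy ha0 hby 𝔭 (le_of_eq (height_augIdealP_holds p))
  have hJfin : lengthAt (IwasawaAlgebra p) (IwasawaAlgebra p ⧸ J) 𝔭 ≠ ⊤ :=
    ne_top_of_le_ne_top hfin h2
  have hn : muInvariant p (IwasawaAlgebra p ⧸ Ideal.span {(p : IwasawaAlgebra p) ^ n * 1}) = n := by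
    rw [BurungaleTian2026.muInvariant_quotient_pow_mul one_ne_zero n]
    have : muInvariant p (IwasawaAlgebra p ⧸ Ideal.span {(1 : IwasawaAlgebra p)}) = 0 := by
      rw [muInvariant_eq_toNat_lengthAt p _ 𝔭 rfl, Ideal.span_singleton_one,
        lengthAt_quotient_eq_zero_of_not_le (fun h ↦ 𝔭.isPrime.ne_top (top_le_iff.mp h))]
      rfl
    rw [this, add_zero]
  rw [muInvariant_eq_toNat_lengthAt p _ 𝔭 rfl, hHZ]
  rw [muInvariant_eq_toNat_lengthAt p _ 𝔭 rfl] at hn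
  calc n = _ := hn.symm
    _ ≤ _ := ENat.toNat_le_toNat h1 hJfin

/-- **The `μ` of `Λ/(a)` vanishes when `a ∉ (p)`** (`Λ/(a)` is killed by `a ∉ 𝔭 = (p)`, so its
localisation at `(p)` is `0`): an element outside `pΛ` is «`p`-free» and Weierstrass-prepares to
(distinguished polynomial) × (unit), whose quotient has no `Λ/(p^{m})` factor.
[cite: Lang1990, Ch. 5 §2 Thm. 2.2 (Weierstrass preparation) and §3 (definition of `p`-free before Lemma 3.2); corollary `μ(Λ/(a)) = 0`] -/
theorem muInvariant_quotient_span_eq_zero_of_not_mem {a : IwasawaAlgebra p} (ha : a ∉ augIdealP p) :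
    muInvariant p (IwasawaAlgebra p ⧸ Ideal.span {a}) = 0 := by
  let 𝔭 : PrimeSpectrum (IwasawaAlgebra p) := ⟨augIdealP p, isPrime_augIdealP_holds p⟩
  have hby : Module.IsTorsionBy (IwasawaAlgebra p) (IwasawaAlgebra p ⧸ Ideal.span {a}) a :=
    (Module.isTorsionBy_quotient_iff _ a).mpr fun y ↦ by
      rw [smul_eq_mul]
      exact Ideal.mul_mem_right y _ (Ideal.mem_span_singleton_self a)
  rw [muInvariant_eq_toNat_lengthAt p _ 𝔭 rfl, lengthAt_eq_zero_of_isTorsionBy hby 𝔭 ha]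
  rfl

/-- **`μ(Λ/(a)) = 0` with `a ≠ 0` forces `a ∉ (p)`** (else `(a) ≤ (p)·Λ` and
`le_muInvariant_quotient_of_le_pow_smul_top` with `n = 1` gives `μ ≥ 1`): the converse reading of
«`p`-free». [cite: Lang1990, Ch. 5 §1 Thm. 1.2 (i) and §3 (`p`-free elements); corollary] -/
theorem not_mem_augIdealP_of_muInvariant_quotient_eq_zero {a : IwasawaAlgebra p} (ha0 : a ≠ 0)
    (h : muInvariant p (IwasawaAlgebra p ⧸ Ideal.span {a}) = 0) : a ∉ augIdealP p := by
  intro hmem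
  have hle : (Ideal.span {a} : Submodule (IwasawaAlgebra p) (IwasawaAlgebra p)) ≤
      (augIdealP p ^ 1) • (⊤ : Submodule (IwasawaAlgebra p) (IwasawaAlgebra p)) := by
    rw [pow_one, Ideal.smul_eq_mul, Ideal.mul_top]
    exact (Ideal.span_singleton_le_iff_mem _).mpr hmem
  have hZ0 : (Ideal.span {a} : Submodule (IwasawaAlgebra p) (IwasawaAlgebra p)) ≠ ⊥ := by
    rw [Ne, Ideal.span_singleton_eq_bot]
    exact ha0
  have h1 := le_muInvariant_quotient_of_le_pow_smul_top
    (LinearEquiv.refl (IwasawaAlgebra p) (IwasawaAlgebra p)) hZ0 hle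
  omega

/-- **`a ∉ (p)` ⟹ the unit-coefficient certificate `∃ n, ‖coeff_n (ι a)‖ = 1`** for the power series
`ι a ∈ ℚ_p⟦T⟧`: «`a` is `p`-free, i.e. `a ∉ pΛ`, i.e. some coefficient of `a` is a unit of `ℤ_p`» (the
condition under which Weierstrass preparation applies; Greenberg–Vatsal's (2)–(3) «`μ = 0`»), via the
tree's `HasUnitContent` dictionary of `GreenbergVatsal2000/CongruentCurves.lean`.
[cite: Lang1990, Ch. 5 §3 (an element of `Λ` is `p`-free iff it does not lie in `pΛ`, iff Weierstrass preparation §2 Thm. 2.2 applies)] -/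
theorem exists_norm_coeff_eq_one_of_not_mem_augIdealP {a : IwasawaAlgebra p} (h : a ∉ augIdealP p) :
    ∃ n : ℕ, ‖PowerSeries.coeff n (iwasawaToPowerSeries p a)‖ = 1 := by
  refine (hasUnitContent_iff_exists_norm_coeff_map_eq_one a).mp
    ((hasUnitContent_iff_not_C_dvd a).mpr fun hd ↦ h ?_)
  rw [augIdealP, Ideal.mem_span_singleton]
  exact hd

end MuQuotient


end Literature.NumberTheory.EllipticCurves

end
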